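import Mathlib
import Summits.ResolutionOfSingularities.ResolutionOfSingularities.Theorems.RadicialJungCleanModelsCleanLUDimCases
import Summits.ResolutionOfSingularities.ResolutionOfSingularities.Theorems.RadicialJungCleanModelsCleanLUDimDefectless
import Summits.ResolutionOfSingularities.ResolutionOfSingularities.Theorems.RadicialJungCleanModelsReductionAt
import HarnessLib

/-!
# Route `RadicialJung`, crux `CleanModels` (stmt-15917), line `Sketch` rev 35, stub 7 `stub_cleanModelsDimGEFour`: the crux IN ONE DIMENSION
# `d = n + 1` from embedded resolution of closed subsets of dimension `≤ n`, the dim-`d` non-discrete defect residue and dim-`d` patching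

Explicit-unit seat `decomp-res-hand-2` g2 (structural hand, stubs 5–7).  OURS; nothing here proves resolution in characteristic `p`.

`…CleanModelsDimGEFourOfEmbRes.lean` (this seat) gives the frontier stub for ALL `dim W ≥ 4` at once from inputs quantified over every `d ≥ 4`.
This file is the GRADED form, one dimension at a time, so that the census can name the price of the FIRST open case exactly:

* `cleanModels_dim_of_embeddedResolution n` — for every regular integral `W`, separated of finite type over a field `k` of characteristic
  `p`, of dimension EXACTLY `n + 1`, and every purely inseparable `L/K(W)` of degree `p`, the conclusion of `CleanModels` holds, GIVEN
  (i) `hEmb_n`: embedded resolution, in the shape of CJS 2020 Cor. 1.5, of closed proper subsets of dimension `≤ n` of regular excellent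
  integral Noetherian schemes (used once: on the remainder hypersurface `g₀ − f₀^p = 0` in `Spec` of the `(n+1)`-dimensional regular local
  ring at the centre of a valuation); (ii) `hND_{n+1}`: clean local uniformization at zero-dimensional NON-DISCRETE DEFECT valuations with an
  `(n+1)`-dimensional regular centre (the dim-`(n+1)` form of the line's research residue, class (B)); (iii) `hZ_{n+1}`: open-form two-model
  patching for `P_clean` in transcendence degree `n + 1` (Piltant 2013 Prop. 5.1 shape).
  Assembly: ✓ `cleanLUZeroDim_dim_of_cases (n+1)` (hand-2 g0; arc class ✓ `Lens5ArcAllDim.cleanLUArcAtDim`) fed with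
  ✓ `cleanLU_dim_of_isMin_pthPowerApprox n hEmb` / ✓ `cleanLU_dim_of_transcendenceDefect_eq_zero n hEmb` (this seat) and `hND`;
  ✓ `cleanCharts_dim_of_cleanLUZeroDim_dim`; ✓ `cleanGlobalization_dim` with `hZ`; ✓ `cleanModelsAt_of_logCleanPrincipalizationAt`.

FIRST OPEN CASE `n = 3` (fourfolds): `hEmb_3` = embedded resolution of closed subsets of dimension `≤ 3` — the case after Cossart–Jannsen–Saito
(`≤ 2`), NOT in print (Cossart–Piltant 2019 is non-embedded resolution of threefolds) —, class (B) in dimension `4`, Piltant patching in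
transcendence degree `4` (open, Piltant 2013 p. 2).  For `n ≤ 2` the statement is true but WEAKER than the skeleton's nodes (`dim ≤ 2` is
✓ F-75c unconditionally; `dim 3` is sourced to printed facts) — it is uniform in `n` by design.  Structural bookkeeping, counted 0.
-/

noncomputable section

set_option linter.dupNamespace false -- mandated namespace of this single-conjunct summit

open CategoryTheory AlgebraicGeometry IsLocalRing
open Literature.AlgebraicGeometry.Resolution Literature.AlgebraicGeometry.Motives

namespace Summit.ResolutionOfSingularities.ResolutionOfSingularities.Theorems.RadicialJung.CleanModels

/-- **`CleanModels` in dimension exactly `n + 1` from `hEmb_n`, `hND_{n+1}`, `hZ_{n+1}`** (module docstring): for `p` prime, `k` of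
characteristic `p`, `W` regular integral separated of finite type over `k` with `dim W = n + 1`, `L/K(W)` purely inseparable of degree `p`,
there is a proper birational regular `V → W` on which, at every point, some `y ∈ L ∖ K(W)` has `y^p = g ∈ K(W)` of toroidal or regular type —
GIVEN embedded resolution of closed subsets of dimension `≤ n` (CJS Cor. 1.5 shape; printed for `n ≤ 2` only), the dim-`(n+1)` non-discrete
defect residue and dim-`(n+1)` two-model patching for `P_clean`.  All three inputs are OPEN for `n ≥ 3`; structural reduction only.
[cite: CossartJannsenSaito2020, Cor. 1.5, p. 7] [cite: Piltant2013, Cor. 5.7 and p. 2] [cite: Kuhlmann2010, Thm. 1.1] -/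
theorem cleanModels_dim_of_embeddedResolution (n : ℕ)
    (hEmb : ∀ (Z : Scheme.{0}) [IsIntegral Z] [IsNoetherian Z], Scheme.IsRegular Z →
      Scheme.IsExcellent Z → ∀ (X : Set Z), IsClosed X → X ≠ Set.univ → topologicalKrullDim X ≤ n →
        ∃ (Z' : Scheme.{0}) (π : Z' ⟶ Z), IsProper π ∧ Function.Surjective π.base ∧
          (∃ U : Z.Opens, (U : Set Z) = Xᶜ ∧ IsIso (π ∣_ U)) ∧
          IsStrictNormalCrossingsDivisor Z' (π.base ⁻¹' X))
    (hND : ∀ (p : ℕ), p.Prime →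
    ∀ (k : Type) [Field k] [CharP k p] (K : Type) [Field K] [Algebra k K]
    (O : ValuationSubring K) (A : Subalgebra k K), A.toSubring ≤ O.toSubring → A.FG → IsFractionRing A K →
    ringKrullDim A ≤ ((n + 1 : ℕ) : WithBot ℕ∞) → IsRegularLocalRing (locAtCentre A.toSubring O) →
    ringKrullDim (locAtCentre A.toSubring O) = ((n + 1 : ℕ) : WithBot ℕ∞) →
    (∀ (T : Subring K) (hT : T ≤ O.toSubring), A.toSubring ≤ T → (subringCentre T O hT).IsMaximal) →
    ∀ g₀ : K, (∀ c : K, c ^ p ≠ g₀) →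
    (∀ f₀ : K, ∃ f₁ : K, O.valuation (g₀ - f₁ ^ p) < O.valuation (g₀ - f₀ ^ p)) →
    (∀ hk : ∀ c : k, algebraMap k K c ∈ O, transcendenceDefect k O hk ≠ 0) →
    ¬ (∃ π : K, π ≠ 0 ∧ (∀ x : K, O.valuation x < 1 → O.valuation x ≤ O.valuation π) ∧
      (∀ x : K, x ≠ 0 → ∃ n : ℕ, O.valuation π ^ n ≤ O.valuation x)) →
    ∃ (A' : Subalgebra k K), A'.toSubring ≤ O.toSubring ∧ A ≤ A' ∧ A'.FG ∧
    ∃ (_ : IsRegularLocalRing (locAtCentre A'.toSubring O)) (c : Fin p → K), (∃ j : Fin p, (j : ℕ) ≠ 0 ∧ c j ≠ 0) ∧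
    ((∃ (d m : ℕ) (hmd : m ≤ d) (t : Fin d → ↥(locAtCentre A'.toSubring O)) (a : Fin m → ℕ) (u : ↥(locAtCentre A'.toSubring O)), IsUnit u ∧
    Ideal.span (Set.range t) = IsLocalRing.maximalIdeal ↥(locAtCentre A'.toSubring O) ∧
    ringKrullDim ↥(locAtCentre A'.toSubring O) = (d : WithBot ℕ∞) ∧ 0 < m ∧ (∀ i, ¬ p ∣ a i) ∧
    (∑ j : Fin p, c j ^ p * g₀ ^ (j : ℕ)) = (u : K) * ∏ i : Fin m, ((t (Fin.castLE hmd i) : ↥(locAtCentre A'.toSubring O)) : K) ^ (a i)) ∨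
    (∃ u : ↥(locAtCentre A'.toSubring O), IsUnit u ∧ (∑ j : Fin p, c j ^ p * g₀ ^ (j : ℕ)) = (u : K) ∧
    ∀ c' : ↥(locAtCentre A'.toSubring O), u - c' ^ p ∉ IsLocalRing.maximalIdeal ↥(locAtCentre A'.toSubring O)) ∨
    (∃ s c' : ↥(locAtCentre A'.toSubring O), (∑ j : Fin p, c j ^ p * g₀ ^ (j : ℕ)) = (s : K) ∧
    s - c' ^ p ∈ IsLocalRing.maximalIdeal ↥(locAtCentre A'.toSubring O) ∧
    s - c' ^ p ∉ IsLocalRing.maximalIdeal ↥(locAtCentre A'.toSubring O) ^ 2)))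
    (hZ : ∀ (p : ℕ), p.Prime → ∀ (k K : Type) [Field k] [CharP k p] [Field K] [Algebra k K] [Algebra.EssFiniteType k K],
    Algebra.trdeg k K = (n + 1 : ℕ) → ∀ (g₀ : K) (M₁ M₂ : ProjModel k K) (U₁ : M₁.X.Opens) (U₂ : M₂.X.Opens),
    (∀ x ∈ U₁, ModelCleanRegAt p g₀ M₁ x) → (∀ x ∈ U₂, ModelCleanRegAt p g₀ M₂ x) →
    ∃ (N : ProjModel k K) (φ₁ : N.Hom M₁) (φ₂ : N.Hom M₂),
    (∀ y : N.X, φ₁.f y ∈ U₁ → ModelCleanRegAt p g₀ N y) ∧ (∀ y : N.X, φ₂.f y ∈ U₂ → ModelCleanRegAt p g₀ N y)) :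
    ∀ p : ℕ, p.Prime → ∀ (k : Type) [Field k] [CharP k p] (W : AlgebraicGeometry.Scheme.{0}) [AlgebraicGeometry.IsIntegral W] (f : W ⟶ AlgebraicGeometry.Spec (.of k)) (L : Type) [Field L] [Algebra W.functionField L], AlgebraicGeometry.IsSeparated f → AlgebraicGeometry.LocallyOfFiniteType f → AlgebraicGeometry.QuasiCompact f → Literature.AlgebraicGeometry.Resolution.Scheme.IsRegular W → IsPurelyInseparable W.functionField L → Module.finrank W.functionField L = p → topologicalKrullDim W = ((n + 1 : ℕ) : WithBot ℕ∞) → ∃ (V : AlgebraicGeometry.Scheme.{0}) (π : V ⟶ W) (_ : AlgebraicGeometry.IsIntegral V) (_ : AlgebraicGeometry.IsDominant π), AlgebraicGeometry.IsProper π ∧ Literature.AlgebraicGeometry.Resolution.IsBirational π ∧ Literature.AlgebraicGeometry.Resolution.Scheme.IsRegular V ∧ (∀ v : V, (∃ (y : L) (g : W.functionField), y ∉ Set.range (algebraMap W.functionField L) ∧ algebraMap W.functionField L g = y ^ p ∧ ((∃ (d m : ℕ) (hmd : m ≤ d) (t : Fin d → V.presheaf.stalk v) (a : Fin m → ℕ),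 Ideal.span (Set.range t) = IsLocalRing.maximalIdeal (V.presheaf.stalk v) ∧ ringKrullDim (V.presheaf.stalk v) = (d : WithBot ℕ∞) ∧ 0 < m ∧ (∀ i, ¬ p ∣ a i) ∧ Literature.AlgebraicGeometry.Motives.RatFn.functionFieldMap π g = ∏ i : Fin m, (algebraMap (V.presheaf.stalk v) V.functionField (t (Fin.castLE hmd i))) ^ (a i)) ∨ (∃ u₀ : V.presheaf.stalk v, IsUnit u₀ ∧ Literature.AlgebraicGeometry.Motives.RatFn.functionFieldMap π g = algebraMap (V.presheaf.stalk v) V.functionField u₀ ∧ ((∀ c : V.presheaf.stalk v, u₀ - c ^ p ∉ IsLocalRing.maximalIdeal (V.presheaf.stalk v)) ∨ (∃ c : V.presheaf.stalk v, u₀ - c ^ p ∈ IsLocalRing.maximalIdeal (V.presheaf.stalk v) ∧ u₀ - c ^ p ∉ IsLocalRing.maximalIdeal (V.presheaf.stalk v) ^ 2)))))) := by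
  intro p hp k _ _ W _ f L _ _ hsep hloc hqc hWreg hPI hdeg hdW
  haveI := hsep; haveI := hloc; haveI := hqc
  refine cleanModelsAt_of_logCleanPrincipalizationAt p hp k W f L hPI hdeg fun g₀ hg₀ => ?_
  refine cleanGlobalization_dim (d := n + 1)
    (cleanCharts_dim_of_cleanLUZeroDim_dim (cleanLUZeroDim_dim_of_cases (n + 1) ?_ ?_ hND)) hZ p hp k W f hWreg hdW g₀ hg₀
  · intro p hp k _ _ K _ _ O A hAO hAfg hfrac _hdimA hreg hdim _hzd g₀ hg₀ f₀ hf₀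
    exact cleanLU_dim_of_isMin_pthPowerApprox n hEmb p hp k K O A hAO hAfg hfrac hreg le_rfl hdim g₀ hg₀ f₀ hf₀
  · intro p hp k _ _ K _ _ O A hAO hAfg hfrac _hdimA hreg hdim _hzd g₀ hg₀ hk htd
    exact cleanLU_dim_of_transcendenceDefect_eq_zero n hEmb p hp k K O A hAO hAfg hfrac hreg le_rfl hdim g₀ hg₀ hk htd

end Summit.ResolutionOfSingularities.ResolutionOfSingularities.Theorems.RadicialJung.CleanModels

end
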